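import Mathlib.Geometry.Manifold.Instances.Icc
import Literature.Topology.FourManifolds.Handles
import HarnessLib

/-!
# Mathlib's interval `[x, y]` is a `0`-handle

The Morse-theoretic handle vocabulary of `Literature/Topology/FourManifolds/Handles.lean`
(`IsHandlebodyOfIndexLE`, `HasHandleDecomposition`) evaluated on Mathlib's own one-dimensional
manifold with boundary, the compact interval `Set.Icc x y` (charts `IccLeftChart` /
`IccRightChart`, model `𝓡∂ 1`, `Mathlib.Geometry.Manifold.Instances.Real`), the interval that
carries Mathlib's paths and the product cobordisms `M × [0, 1]` of `CobordismProofs.lean`: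
`[x, y]` is a handlebody with a single handle, of index `0`,

* `Literature.Topology.FourManifolds.isHandlebodyOfIndexLE_zero_Icc :
    IsHandlebodyOfIndexLE 0 0 (Icc x y)`,
* `Literature.Topology.FourManifolds.hasHandleDecomposition_Icc :
    HasHandleDecomposition 0 (Icc x y) (fun k => if k = 0 then 1 else 0)`.

This is the companion, for the type `Icc x y`, of `ClosedBallHandles.lean`, which proves the same
for the closed unit ball `𝔻ⁿ⁺¹ ⊆ ℝⁿ⁺¹` of every dimension with the height function `‖x‖²`
(`Literature.Topology.FourManifolds.isHandlebodyOfIndexLE_closedBall`); the two types are not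
related by anything in the library, and the present file is elementary (no facts used).

The Morse function is `f z = 1 + (z - x) * (z - y)`: it is `1` exactly on `∂[x, y] = {x, y}`,
where `f' = ∓ (y - x) ≠ 0`, it is `< 1` on `(x, y)`, and its only critical point is the
midpoint, where the Hessian is `2 · u₀ w₀`, nondegenerate of index `0`.  This is the `n + 1 = 1`
case of "`Dⁿ⁺¹` is a `0`-handle" (Milnor, *Morse theory* (1963), §3, Thms. 3.1–3.2 and the
example of the height function; Kosinski, *Differential Manifolds* (1993), VI.6 and VII.2;
Matsumoto, *An introduction to Morse theory* (2001), Def. 3.3 and Thm. 3.4).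

On the way we compute, for functions of the form `z ↦ ψ z.val` on `Icc x y` (`ψ : ℝ → ℝ`):
the manifold derivative along the unit tangent vector (`mfderiv_comp_val_Icc_apply_one`), the
critical-point criterion `IsMCriticalPt ↔ deriv ψ z = 0` (`isMCriticalPt_comp_val_Icc_iff`) and
the Hessian `mhessian` at interior points (`mhessian_comp_val_Icc_apply`), all by unfolding
Mathlib's charts `IccLeftChart` / `IccRightChart` (`Mathlib.Geometry.Manifold.Instances.Real`).

The handle predicates are phrased for the model `𝓡∂ (n + 1)`; with `n = 0` the instance
`ChartedSpace (EuclideanHalfSpace (0 + 1)) (Icc x y)` is Mathlib's `instIccChartedSpace x y`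
(for `EuclideanHalfSpace 1`), supplied explicitly in the statements through `haveI` since
instance search does not unfold `0 + 1`.

## References

* J. Milnor, *Morse theory*, Ann. of Math. Studies 51, Princeton (1963), §3.
* A. Kosinski, *Differential Manifolds*, Academic Press (1993), VI.6, VII.1–2.
* Y. Matsumoto, *An introduction to Morse theory*, AMS (2001), Ch. 3.
-/

open scoped Manifold ContDiff Topology
open Set Function Fact.Manifold

noncomputable section

namespace Literature.Topology.FourManifolds

variable {x y : ℝ} [hxy : Fact (x < y)]

/-! ### Functions `z ↦ ψ z` on the interval -/

/-- The manifold derivative of `z ↦ ψ z` on `[x, y]` along the unit tangent vector `1` is the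
ordinary derivative `ψ' z` (chain rule with `mfderiv_subtype_coe_Icc_one`). [folklore] -/
theorem mfderiv_comp_val_Icc_apply_one {ψ : ℝ → ℝ} (z : Icc x y)
    (hψ : DifferentiableAt ℝ ψ z) :
    mfderiv (𝓡∂ 1) 𝓘(ℝ, ℝ) (fun w : Icc x y => ψ w) z 1 = deriv ψ z := by
  have hval : MDifferentiableAt (𝓡∂ 1) 𝓘(ℝ, ℝ) (Subtype.val : Icc x y → ℝ) z :=
    (contMDiff_subtype_coe_Icc (n := 1)).mdifferentiableAt one_ne_zero
  have hψ' : MDifferentiableAt 𝓘(ℝ, ℝ) 𝓘(ℝ, ℝ) ψ (z : ℝ) :=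
    mdifferentiableAt_iff_differentiableAt.mpr hψ
  have hcomp : HasMFDerivAt (𝓡∂ 1) 𝓘(ℝ, ℝ) (fun w : Icc x y => ψ w) z
      ((mfderiv 𝓘(ℝ, ℝ) 𝓘(ℝ, ℝ) ψ z).comp
        (mfderiv (𝓡∂ 1) 𝓘(ℝ, ℝ) (Subtype.val : Icc x y → ℝ) z)) :=
    hψ'.hasMFDerivAt.comp z hval.hasMFDerivAt
  rw [hcomp.mfderiv, ContinuousLinearMap.comp_apply, mfderiv_subtype_coe_Icc_one,
    mfderiv_eq_fderiv]
  exact fderiv_apply_one_eq_deriv (𝕜 := ℝ) (f := ψ) (x := (z : ℝ))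

/-- Critical points of `z ↦ ψ z` on `[x, y]` (in the sense of `IsMCriticalPt`, vanishing
manifold derivative for `𝓡∂ 1`) are exactly the zeros of `ψ'` — including at the two boundary
points, where the manifold derivative is the one-sided derivative. [folklore] -/
theorem isMCriticalPt_comp_val_Icc_iff {ψ : ℝ → ℝ} (z : Icc x y)
    (hψ : DifferentiableAt ℝ ψ z) :
    IsMCriticalPt (𝓡∂ 1) (fun w : Icc x y => ψ w) z ↔ deriv ψ z = 0 := by
  constructor
  · intro hc
    rw [← mfderiv_comp_val_Icc_apply_one z hψ]
    rw [IsMCriticalPt] at hc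
    rw [hc]
    rfl
  · intro h0
    have hval : MDifferentiableAt (𝓡∂ 1) 𝓘(ℝ, ℝ) (Subtype.val : Icc x y → ℝ) z :=
      (contMDiff_subtype_coe_Icc (n := 1)).mdifferentiableAt one_ne_zero
    have hψ' : MDifferentiableAt 𝓘(ℝ, ℝ) 𝓘(ℝ, ℝ) ψ (z : ℝ) :=
      mdifferentiableAt_iff_differentiableAt.mpr hψ
    have hfd : fderiv ℝ ψ z = 0 := by
      apply ContinuousLinearMap.ext_ring
      rw [fderiv_apply_one_eq_deriv, h0]
      rfl
    have hcomp : HasMFDerivAt (𝓡∂ 1) 𝓘(ℝ, ℝ) (fun w : Icc x y => ψ w) z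
        ((mfderiv 𝓘(ℝ, ℝ) 𝓘(ℝ, ℝ) ψ z).comp
          (mfderiv (𝓡∂ 1) 𝓘(ℝ, ℝ) (Subtype.val : Icc x y → ℝ) z)) :=
      hψ'.hasMFDerivAt.comp z hval.hasMFDerivAt
    unfold IsMCriticalPt
    rw [hcomp.mfderiv, mfderiv_eq_fderiv, hfd]
    exact ContinuousLinearMap.zero_comp _

/-- In the chart at a point `z < y` of `[x, y]` (the left chart `t ↦ t - x`), the function
`z ↦ ψ z` reads `v ↦ ψ (min (max v₀ 0 + x) y)` (unfolding `IccLeftChart` and `𝓡∂ 1`).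
[folklore] -/
theorem writtenInExtChartAt_comp_val_Icc {ψ : ℝ → ℝ} (z : Icc x y) (hz : z.val < y)
    (v : EuclideanSpace ℝ (Fin 1)) :
    writtenInExtChartAt (𝓡∂ 1) 𝓘(ℝ, ℝ) z (fun w : Icc x y => ψ w) v =
      ψ (min (max (v.ofLp 0) 0 + x) y) := by
  simp [writtenInExtChartAt, extChartAt, chartAt, hz, IccLeftChart,
    modelWithCornersEuclideanHalfSpace]

/-- The chart at a point `z < y` of `[x, y]` sends `z` to the vector `(z - x)`. [folklore] -/
theorem extChartAt_Icc_apply_self (z : Icc x y) (hz : z.val < y) :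
    extChartAt (𝓡∂ 1) z z = WithLp.toLp 2 (fun _ => z.val - x) := by
  simp [extChartAt, chartAt, hz, IccLeftChart, modelWithCornersEuclideanHalfSpace]

/-- **Hessian on the interval.**  At an interior point `z ∈ (x, y)` the Hessian (`mhessian`,
second derivative in the preferred chart) of `z ↦ ψ z`, `ψ` of class `C²`, is the bilinear form
`(u, w) ↦ ψ'' z · u₀ · w₀` on the model space `ℝ¹`. [folklore] -/
theorem mhessian_comp_val_Icc_apply {ψ : ℝ → ℝ} (hψ : ContDiff ℝ 2 ψ) (z : Icc x y)
    (hz : x < z.val ∧ z.val < y) (u w : EuclideanSpace ℝ (Fin 1)) :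
    mhessian (𝓡∂ 1) (fun w : Icc x y => ψ w) z u w =
      deriv (deriv ψ) z * u.ofLp 0 * w.ofLp 0 := by
  -- the point, the coordinate projection, and the function in the chart
  set p : EuclideanSpace ℝ (Fin 1) := extChartAt (𝓡∂ 1) z z with hp
  have hp' : p = WithLp.toLp 2 (fun _ => z.val - x) := extChartAt_Icc_apply_self z hz.2
  have hp0 : p.ofLp 0 = z.val - x := by rw [hp']
  set π₀ : EuclideanSpace ℝ (Fin 1) →L[ℝ] ℝ := PiLp.proj 2 (fun _ : Fin 1 => ℝ) 0
  have hπ₀v : ∀ v : EuclideanSpace ℝ (Fin 1), π₀ v = v.ofLp 0 := fun v => rfl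
  have hψd : Differentiable ℝ ψ := hψ.differentiable (by norm_num)
  have hψd' : Differentiable ℝ (deriv ψ) := by
    have h2 : ContDiff ℝ (1 + 1) ψ := hψ
    exact (contDiff_succ_iff_deriv.mp h2).2.2.differentiable (by norm_num)
  -- Step 1: near `p` the written function is `v ↦ ψ (v₀ + x)`
  have hU : {v : EuclideanSpace ℝ (Fin 1) | 0 < v.ofLp 0 ∧ v.ofLp 0 < y - x} ∈ 𝓝 p := by
    apply IsOpen.mem_nhds
    · exact (isOpen_lt continuous_const (PiLp.continuous_apply 2 _ 0)).inter
        (isOpen_lt (PiLp.continuous_apply 2 _ 0) continuous_const)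
    · simp only [mem_setOf_eq, hp0]
      constructor <;> linarith [hz.1, hz.2]
  have hF : writtenInExtChartAt (𝓡∂ 1) 𝓘(ℝ, ℝ) z (fun w : Icc x y => ψ w) =ᶠ[𝓝 p]
      fun v => ψ (π₀ v + x) := by
    filter_upwards [hU] with v hv
    rw [writtenInExtChartAt_comp_val_Icc z hz.2, hπ₀v, max_eq_left hv.1.le,
      min_eq_left (by linarith [hv.2])]
  -- Step 2: the model range is a neighbourhood of every point near `p`
  have hS : ∀ᶠ v in 𝓝 p, range (𝓡∂ 1) ∈ 𝓝 v := by
    filter_upwards [hU] with v hv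
    rw [range_modelWithCornersEuclideanHalfSpace]
    exact Filter.mem_of_superset
      ((isOpen_lt continuous_const (PiLp.continuous_apply 2 _ 0)).mem_nhds hv.1)
      fun w hw => show 0 ≤ w.ofLp 0 from le_of_lt hw
  -- Step 3: first derivative of the model function
  have hdF : ∀ v : EuclideanSpace ℝ (Fin 1),
      HasFDerivAt (fun v => ψ (π₀ v + x)) (deriv ψ (π₀ v + x) • π₀) v := fun v =>
    (hψd _).hasDerivAt.comp_hasFDerivAt v (π₀.hasFDerivAt.add_const x)
  have hG : fderivWithin ℝ
      (writtenInExtChartAt (𝓡∂ 1) 𝓘(ℝ, ℝ) z (fun w : Icc x y => ψ w)) (range (𝓡∂ 1))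
      =ᶠ[𝓝 p] fun v => deriv ψ (π₀ v + x) • π₀ := by
    filter_upwards [hF.eventually_nhds, hS] with v hv hSv
    rw [fderivWithin_of_mem_nhds hSv, Filter.EventuallyEq.fderiv_eq hv, (hdF v).fderiv]
  -- Step 4: second derivative of the model function at `p`
  have hdG : HasFDerivAt (fun v : EuclideanSpace ℝ (Fin 1) => deriv ψ (π₀ v + x) • π₀)
      ((deriv (deriv ψ) (π₀ p + x) • π₀).smulRight π₀) p :=
    ((hψd' _).hasDerivAt.comp_hasFDerivAt p (π₀.hasFDerivAt.add_const x)).smul_const π₀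
  -- Step 5: assemble
  have h2 : fderivWithin ℝ (fderivWithin ℝ
        (writtenInExtChartAt (𝓡∂ 1) 𝓘(ℝ, ℝ) z (fun w : Icc x y => ψ w)) (range (𝓡∂ 1)))
      (range (𝓡∂ 1)) p = (deriv (deriv ψ) (π₀ p + x) • π₀).smulRight π₀ := by
    rw [Filter.EventuallyEq.fderivWithin_eq (hG.filter_mono nhdsWithin_le_nhds) hG.eq_of_nhds,
      fderivWithin_of_mem_nhds hS.self_of_nhds, hdG.fderiv]
  have hzx : π₀ p + x = z.val := by rw [hπ₀v, hp0]; ring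
  show ((fderivWithin ℝ (fderivWithin ℝ
          (writtenInExtChartAt (𝓡∂ 1) 𝓘(ℝ, ℝ) z (fun w : Icc x y => ψ w)) (range (𝓡∂ 1)))
        (range (𝓡∂ 1)) p) u) w = _
  rw [h2, hzx]
  simp only [ContinuousLinearMap.smulRight_apply, FunLike.coe_smul, Pi.smul_apply, hπ₀v,
    smul_eq_mul]

/-- At an interior point where `ψ'' z ≠ 0`, the Hessian of `z ↦ ψ z` on `[x, y]` is
nondegenerate (it is `ψ'' z · u₀ w₀` on `ℝ¹`). [folklore] -/
theorem mhessian_comp_val_Icc_nondegenerate {ψ : ℝ → ℝ} (hψ : ContDiff ℝ 2 ψ)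
    (z : Icc x y)
    (hz : x < z.val ∧ z.val < y) (h2 : deriv (deriv ψ) z ≠ 0) :
    (mhessian (𝓡∂ 1) (fun w : Icc x y => ψ w) z).Nondegenerate := by
  have key : ∀ u : EuclideanSpace ℝ (Fin 1),
      mhessian (𝓡∂ 1) (fun w : Icc x y => ψ w) z u u = 0 → u = 0 := by
    intro u hu
    rw [mhessian_comp_val_Icc_apply hψ z hz] at hu
    have hu0 : u.ofLp 0 = 0 := by
      rcases mul_eq_zero.mp hu with h | h
      · rcases mul_eq_zero.mp h with h' | h'
        · exact absurd h' h2
        · exact h'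
      · exact h
    ext i
    fin_cases i
    simpa using hu0
  constructor
  · intro u hu
    exact key u (hu u)
  · intro u hu
    exact key u (hu u)

/-- At an interior point where `ψ'' z ≥ 0`, the Morse index of `z ↦ ψ z` on `[x, y]` is `0`:
the Hessian `ψ'' z · u₀²` is positive semidefinite, so no line is negative definite
(`QuadraticForm.sigPos_add_finrank_le_of_nonpos`). [folklore] -/
theorem morseIndex_comp_val_Icc_eq_zero {ψ : ℝ → ℝ} (hψ : ContDiff ℝ 2 ψ) (z : Icc x y)
    (hz : x < z.val ∧ z.val < y) (h2 : 0 ≤ deriv (deriv ψ) z) :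
    morseIndex (𝓡∂ 1) (fun w : Icc x y => ψ w) z = 0 := by
  unfold morseIndex sigNeg
  set Q := (mhessian (𝓡∂ 1) (fun w : Icc x y => ψ w) z).toQuadraticMap with hQ
  have hnonpos : ∀ u ∈ (⊤ : Submodule ℝ (EuclideanSpace ℝ (Fin 1))), (-Q) u ≤ 0 := by
    intro u _
    rw [QuadraticMap.neg_apply, neg_nonpos, hQ, LinearMap.BilinMap.toQuadraticMap_apply,
      mhessian_comp_val_Icc_apply hψ z hz]
    have : 0 ≤ u.ofLp 0 * u.ofLp 0 := mul_self_nonneg _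
    nlinarith
  have := QuadraticForm.sigPos_add_finrank_le_of_nonpos hnonpos
  rw [finrank_top] at this
  omega

/-! ### The `0`-handle `[x, y]` -/

/-- The boundary of `[x, y]` consists of the two endpoints (Mathlib's `boundary_Icc`), as a
statement about `z.val`. [folklore] -/
theorem mem_boundary_Icc_iff (z : Icc x y) :
    z ∈ (𝓡∂ 1).boundary (Icc x y) ↔ z.val = x ∨ z.val = y := by
  rw [boundary_Icc]
  simp only [mem_insert_iff, mem_singleton_iff]
  constructor
  · rintro (rfl | rfl)
    · exact Or.inl (Set.Icc.coe_bot x y)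
    · exact Or.inr (Set.Icc.coe_top x y)
  · rintro (h | h)
    · left; exact Subtype.ext (by simpa using h)
    · right; exact Subtype.ext (by simpa using h)

/-- The interior of `[x, y]` is `(x, y)`, as a statement about `z.val`. [folklore] -/
theorem mem_interior_Icc_iff (z : Icc x y) :
    z ∈ (𝓡∂ 1).interior (Icc x y) ↔ x < z.val ∧ z.val < y := by
  rw [← ModelWithCorners.compl_boundary, mem_compl_iff, mem_boundary_Icc_iff, not_or]
  constructor
  · rintro ⟨h1, h2⟩
    exact ⟨lt_of_le_of_ne z.2.1 (Ne.symm h1), lt_of_le_of_ne z.2.2 h2⟩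
  · rintro ⟨h1, h2⟩
    exact ⟨ne_of_gt h1, ne_of_lt h2⟩

omit hxy in
/-- Derivative of the model Morse function `t ↦ 1 + (t - x)(t - y)`: `2t - x - y`. [folklore] -/
theorem hasDerivAt_one_add_mul_sub (t : ℝ) :
    HasDerivAt (fun t : ℝ => 1 + (t - x) * (t - y)) (2 * t - x - y) t := by
  have h1 : HasDerivAt (fun t : ℝ => t - x) 1 t := (hasDerivAt_id t).sub_const x
  have h2 : HasDerivAt (fun t : ℝ => t - y) 1 t := (hasDerivAt_id t).sub_const y
  exact ((h1.fun_mul h2).const_add 1).congr_deriv (by ring)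

omit hxy in
/-- `deriv` of the model Morse function `t ↦ 1 + (t - x)(t - y)`. [folklore] -/
theorem deriv_one_add_mul_sub :
    deriv (fun t : ℝ => 1 + (t - x) * (t - y)) = fun t => 2 * t - x - y :=
  funext fun t => (hasDerivAt_one_add_mul_sub t).deriv

omit hxy in
/-- Second `deriv` of the model Morse function `t ↦ 1 + (t - x)(t - y)` is `2`. [folklore] -/
theorem deriv_deriv_one_add_mul_sub (t : ℝ) :
    deriv (deriv (fun t : ℝ => 1 + (t - x) * (t - y))) t = 2 := by
  rw [deriv_one_add_mul_sub]
  have : HasDerivAt (fun t : ℝ => 2 * t - x - y) 2 t := by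
    simpa using (((hasDerivAt_id t).const_mul 2).sub_const x).sub_const y
  exact this.deriv

/-- The critical points of `z ↦ 1 + (z - x)(z - y)` on `[x, y]`: exactly the midpoint.
[folklore] -/
theorem isMCriticalPt_one_add_mul_sub_iff (z : Icc x y) :
    IsMCriticalPt (𝓡∂ 1) (fun w : Icc x y => 1 + ((w : ℝ) - x) * ((w : ℝ) - y)) z ↔
      2 * z.val = x + y := by
  have hd : DifferentiableAt ℝ (fun t : ℝ => 1 + (t - x) * (t - y)) z :=
    (hasDerivAt_one_add_mul_sub (x := x) (y := y) z).differentiableAt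
  rw [isMCriticalPt_comp_val_Icc_iff (ψ := fun t : ℝ => 1 + (t - x) * (t - y)) z hd,
    deriv_one_add_mul_sub]
  constructor <;> intro h <;> linarith

/-- **`[x, y]` is a `0`-handle.**  The function `z ↦ 1 + (z - x)(z - y)` is a Morse function on
the manifold with boundary `[x, y]` adapted to the boundary (`≡ 1` and regular on `{x, y}`, `< 1`
inside) whose unique critical point, the midpoint, has index `0`; hence `[x, y] ≅ D¹` is a
handlebody with handles of index `≤ 0` in the sense of `IsHandlebodyOfIndexLE` (Milnor 1963, §3;
Kosinski 1993, VI.6 and VII.2; Matsumoto 2001, Def. 3.3, Thm. 3.4: `Dᵐ` is the `0`-handle).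
[cite: Kosinski1993, VII.2] -/
theorem isMorseAdapted_one_add_mul_sub :
    IsMorseAdapted (𝓡∂ 1) (fun w : Icc x y => 1 + ((w : ℝ) - x) * ((w : ℝ) - y)) ∧
      ∀ z : Icc x y,
        IsMCriticalPt (𝓡∂ 1) (fun w : Icc x y => 1 + ((w : ℝ) - x) * ((w : ℝ) - y)) z →
          morseIndex (𝓡∂ 1) (fun w : Icc x y => 1 + ((w : ℝ) - x) * ((w : ℝ) - y)) z = 0 := by
  have hψ : ContDiff ℝ ∞ (fun t : ℝ => 1 + (t - x) * (t - y)) := by fun_prop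
  have hψ2 : ContDiff ℝ 2 (fun t : ℝ => 1 + (t - x) * (t - y)) := by fun_prop
  -- the midpoint is interior
  have hmid : ∀ z : Icc x y, 2 * z.val = x + y → x < z.val ∧ z.val < y := by
    intro z hz
    constructor <;> linarith [hxy.out]
  refine ⟨⟨⟨?_, ?_⟩, ?_, ?_⟩, ?_⟩
  · -- smooth
    exact hψ.comp_contMDiff contMDiff_subtype_coe_Icc
  · -- nondegenerate at critical points
    intro z hz
    rw [isMCriticalPt_one_add_mul_sub_iff] at hz
    exact mhessian_comp_val_Icc_nondegenerate hψ2 z (hmid z hz)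
      (by rw [deriv_deriv_one_add_mul_sub]; norm_num)
  · -- `≡ 1` and regular on the boundary
    intro z hz
    rw [mem_boundary_Icc_iff] at hz
    refine ⟨?_, ?_⟩
    · rcases hz with h | h <;> simp [h]
    · rw [isMCriticalPt_one_add_mul_sub_iff]
      rcases hz with h | h <;> rw [h] <;> linarith [hxy.out]
  · -- `< 1` inside
    intro z hz
    rw [mem_interior_Icc_iff] at hz
    have : (z.val - x) * (z.val - y) < 0 := mul_neg_of_pos_of_neg (by linarith) (by linarith)
    change 1 + (z.val - x) * (z.val - y) < 1
    linarith
  · -- index `0` at the (unique) critical point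
    intro z hz
    rw [isMCriticalPt_one_add_mul_sub_iff] at hz
    exact morseIndex_comp_val_Icc_eq_zero hψ2 z (hmid z hz)
      (by rw [deriv_deriv_one_add_mul_sub]; norm_num)

/-- **The interval is a handlebody with handles of index `≤ 0`** (`IsHandlebodyOfIndexLE 0 0`):
a non-vacuity witness for `Literature.Topology.FourManifolds.IsHandlebodyOfIndexLE` beyond the
empty manifold, the case `Dⁿ⁺¹ = D¹` of "the disc is a `0`-handle" (Milnor 1963, §3;
Kosinski 1993, VI.6, VII.2; Matsumoto 2001, Def. 3.3). [cite: Kosinski1993, VII.2] -/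
theorem isHandlebodyOfIndexLE_zero_Icc :
    haveI : ChartedSpace (EuclideanHalfSpace (0 + 1)) (Icc x y) := instIccChartedSpace x y
    IsHandlebodyOfIndexLE 0 0 (Icc x y) :=
  ⟨fun w : Icc x y => 1 + ((w : ℝ) - x) * ((w : ℝ) - y), isMorseAdapted_one_add_mul_sub.1,
    fun z hz => (isMorseAdapted_one_add_mul_sub.2 z hz).le⟩

/-- The interval is a handlebody with handles of index `≤ k`, for every `k`.
[cite: Kosinski1993, VII.2] -/
theorem isHandlebodyOfIndexLE_Icc (k : ℕ) :
    haveI : ChartedSpace (EuclideanHalfSpace (0 + 1)) (Icc x y) := instIccChartedSpace x y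
    IsHandlebodyOfIndexLE 0 k (Icc x y) := by
  letI : ChartedSpace (EuclideanHalfSpace (0 + 1)) (Icc x y) := instIccChartedSpace x y
  exact isHandlebodyOfIndexLE_zero_Icc.mono (Nat.zero_le k)

/-- **Handle decomposition of the interval**: `[x, y]` has a handle decomposition with exactly one
`0`-handle and no other handles (`HasHandleDecomposition 0 (Icc x y) (1, 0, 0, …)`), read off from
the Morse function `z ↦ 1 + (z - x)(z - y)` with its single critical point of index `0`
(Milnor 1963, §3; Kosinski 1993, VII.2; Matsumoto 2001, Thm. 3.4). [cite: Kosinski1993, VII.2] -/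
theorem hasHandleDecomposition_Icc :
    haveI : ChartedSpace (EuclideanHalfSpace (0 + 1)) (Icc x y) := instIccChartedSpace x y
    HasHandleDecomposition 0 (Icc x y) (fun k => if k = 0 then 1 else 0) := by
  refine ⟨fun w : Icc x y => 1 + ((w : ℝ) - x) * ((w : ℝ) - y),
    isMorseAdapted_one_add_mul_sub.1, fun k => ?_⟩
  -- the midpoint
  set m : Icc x y := ⟨(x + y) / 2, by constructor <;> linarith [hxy.out]⟩ with hm
  have hcrit : ∀ z : Icc x y,
      IsMCriticalPt (𝓡∂ 1) (fun w : Icc x y => 1 + ((w : ℝ) - x) * ((w : ℝ) - y)) z ↔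
        z = m := by
    intro z
    rw [isMCriticalPt_one_add_mul_sub_iff, Subtype.ext_iff]
    constructor <;> intro h
    · show z.val = (x + y) / 2
      linarith
    · rw [show z.val = (x + y) / 2 from h]; ring
  by_cases hk : k = 0
  · subst hk
    have : criticalSetOfIndex (𝓡∂ 1)
        (fun w : Icc x y => 1 + ((w : ℝ) - x) * ((w : ℝ) - y)) 0 = {m} := by
      ext z
      rw [mem_criticalSetOfIndex, mem_singleton_iff]
      constructor
      · exact fun hz => (hcrit z).mp hz.1
      · intro hz
        have hc := (hcrit z).mpr hz
        exact ⟨hc, isMorseAdapted_one_add_mul_sub.2 z hc⟩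
    simp [this]
  · have : criticalSetOfIndex (𝓡∂ 1)
        (fun w : Icc x y => 1 + ((w : ℝ) - x) * ((w : ℝ) - y)) k = ∅ := by
      ext z
      rw [mem_criticalSetOfIndex]
      simp only [mem_empty_iff_false, iff_false, not_and]
      intro hc hk'
      exact hk (hk'.symm.trans (isMorseAdapted_one_add_mul_sub.2 z hc))
    simp [this, hk]

end Literature.Topology.FourManifolds
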